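import Summits.CriticalPhenomena.PercolationContinuityZ3.Theorems.SahiMasterFamilyFCrossInductionAB
import Mathlib.Tactic.Linarith
import Mathlib.Tactic.Ring
import HarnessLib

/-!
# The `F`-inequality: two elementary closure steps for the third event (OR / AND with a coordinate)

Support file (cell `prim-bnk`, seat bnk-2 gen 19; `--supports stmt-CriticalPhenomena-4575`; memo
`run/shared/lean/prim/prim-l12/FROM-prim-bnk-2-g19-F-CLOSURE.md`).  No definition, no `sorry`, standard axioms.

Recall (`prim-master-conj` gen 20/21, `…ZeroFlagMinorF`, `…FInequalityFreeCoordinates`) the conjectured inequality for increasing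
events `A, B, G` under a product measure, `F(A,B;G) := (1 + μG)·μ(A∩B∩G) − μG·μ(A∩B) − μ(A∩G)·μ(B∩G) ≥ 0`, and its one-coordinate
Bernstein form `F = (1−t)²·F(A⁰,B⁰;G⁰) + t²·F(A¹,B¹;G¹) + t(1−t)·X_e` (`SahiFInduction.F_bernstein_secAt`, `t = p_e`, `X^b = X^{e←b}`).
Collecting terms, the cross coefficient is the "crossed `F`"
  `X_e = μ(A⁰B⁰G⁰) + μ(A¹B¹G¹) − μ(A⁰G⁰)μ(B¹G¹) − μ(A¹G¹)μ(B⁰G⁰) − μ(G¹)μ(A⁰B⁰∖G⁰) − μ(G⁰)μ(A¹B¹∖G¹)`.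
This file proves, by two Harris inequalities and one inclusion–exclusion step,
* `cross_ge_annulus` — **`X_e ≥ [μ(A¹B¹G¹) − μ(A¹B¹G⁰)] − μG¹·[μ(A⁰B⁰) − μ(A⁰B⁰G⁰)] − μG⁰·[μ(A¹B¹) − μ(A¹B¹G¹)]`** for increasing `A, B, G`;
* `cross_nonneg_of_inter_secAt_true_subset` — hence **`X_e ≥ 0` whenever `A¹ ∩ B¹ ⊆ G¹`** (no induction hypothesis needed), and
  `cross_nonneg_of_secAt_false_third_eq_empty` — **`X_e ≥ 0` whenever `G⁰ = ∅`** (Harris for `(A⁰∩B⁰, G¹)`);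
* the two CLOSURE STEPS for the class `{G : F(A,B;G) ≥ 0 for all increasing A, B}`:
  `F_nonneg_forall_of_secAt_true_third_eq_univ` — **if `{ω | e ∈ ω} ⊆ G` (i.e. `G = x_e ∨ H`, `G¹ = univ`) and `F(·,·;G⁰) ≥ 0` for all
  increasing pairs, then `F(·,·;G) ≥ 0` for all increasing pairs**; `F_nonneg_forall_of_secAt_false_third_eq_empty` — **if
  `G ⊆ {ω | e ∈ ω}` (i.e. `G = x_e ∧ H`, `G⁰ = ∅`) and `F(·,·;G¹) ≥ 0` for all increasing pairs, then `F(·,·;G) ≥ 0` for all increasing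
  pairs** (pointwise versions `F_nonneg_of_inter_secAt_true_subset`, `F_nonneg_of_secAt_false_third_eq_empty`, and the Harris case
  `F_nonneg_of_inter_subset_third`: `A ∩ B ⊆ G ⟹ F ≥ 0`).
Together with the kernel classes of `prim-master-conj` gen 21 (third event on ≤ 2 coordinates) this puts `F ≥ 0` in the kernel for every
third event built from a coordinate by repeatedly adjoining a coordinate with `∨` or `∧` (all "caterpillar" read-once formulas
`x₁ ∘₁ (x₂ ∘₂ (⋯ ∘ x_r))`), for all increasing `A, B`; on paper (their junta / two-generator theorems) the innermost block may be any
`≤ 6`-junta or two-generator event.  HONEST FRAMING: elementary closure steps; `F ≥ 0` in general remains OPEN. [this work]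
-/

noncomputable section

open scoped Classical

namespace Summit.CriticalPhenomena.PercolationContinuityZ3.Theorems

namespace SahiFInduction

open Finset Function
open Literature.Combinatorics.Sahi2008
open Literature.Probability.Percolation.DecisionTree (ind ind_of_mem ind_of_not_mem ind_nonneg)
open Literature.Probability.Percolation.BHK2006 (weight_nonneg)

variable {κ : Type} [Fintype κ]

local notation3 (prettyPrint := false) "μ⟦" p ", " X "⟧" => ex (bernoulliWeight p) (ind X)

/-! ### 0. Plumbing -/

/-- Monotonicity of `μ_p` under inclusion. [folklore] -/
private theorem mu_mono (p : κ → unitInterval) {X Y : Set (Set κ)} (h : X ⊆ Y) : μ⟦p, X⟧ ≤ μ⟦p, Y⟧ := by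
  refine ex_mono (fun ω => weight_nonneg (fun i => (p i).2.1) (fun i => (p i).2.2) ω) (fun ω => ?_)
  by_cases hx : ω ∈ X
  · rw [ind_of_mem hx, ind_of_mem (h hx)]
  · rw [ind_of_not_mem hx]; exact ind_nonneg Y ω

/-- Four-set exchange inequality: for `P ⊆ P'`, `Q ⊆ Q'`, `μ(P∩Q') + μ(P'∩Q) ≤ μ(P'∩Q') + μ(P∩Q)` (pointwise on indicators:
on `P` both sides are `1_{Q'} + 1_Q`, off `P` the left side is `1_{P'∩Q} ≤ 1_{P'∩Q'}`). [folklore] -/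
private theorem mu_exchange (p : κ → unitInterval) {P P' Q Q' : Set (Set κ)} (hP : P ⊆ P') (hQ : Q ⊆ Q') :
    μ⟦p, P ∩ Q'⟧ + μ⟦p, P' ∩ Q⟧ ≤ μ⟦p, P' ∩ Q'⟧ + μ⟦p, P ∩ Q⟧ := by
  rw [← ex_add, ← ex_add]
  refine ex_mono (fun ω => weight_nonneg (fun i => (p i).2.1) (fun i => (p i).2.2) ω) (fun ω => ?_)
  simp only [Pi.add_apply]
  by_cases hPω : ω ∈ P
  · have hP'ω : ω ∈ P' := hP hPω
    by_cases hQ'ω : ω ∈ Q'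
    · rw [ind_of_mem (show ω ∈ P ∩ Q' from ⟨hPω, hQ'ω⟩), ind_of_mem (show ω ∈ P' ∩ Q' from ⟨hP'ω, hQ'ω⟩)]
      by_cases hQω : ω ∈ Q
      · rw [ind_of_mem (show ω ∈ P' ∩ Q from ⟨hP'ω, hQω⟩), ind_of_mem (show ω ∈ P ∩ Q from ⟨hPω, hQω⟩)]
      · rw [ind_of_not_mem (show ω ∉ P' ∩ Q from fun h => hQω h.2), ind_of_not_mem (show ω ∉ P ∩ Q from fun h => hQω h.2)]
    · have hQω : ω ∉ Q := fun h => hQ'ω (hQ h)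
      rw [ind_of_not_mem (show ω ∉ P ∩ Q' from fun h => hQ'ω h.2), ind_of_not_mem (show ω ∉ P' ∩ Q' from fun h => hQ'ω h.2),
        ind_of_not_mem (show ω ∉ P' ∩ Q from fun h => hQω h.2), ind_of_not_mem (show ω ∉ P ∩ Q from fun h => hQω h.2)]
  · rw [ind_of_not_mem (show ω ∉ P ∩ Q' from fun h => hPω h.1), ind_of_not_mem (show ω ∉ P ∩ Q from fun h => hPω h.1),
      zero_add, add_zero]
    by_cases h : ω ∈ P' ∩ Q
    · rw [ind_of_mem h, ind_of_mem (show ω ∈ P' ∩ Q' from ⟨h.1, hQ h.2⟩)]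
    · rw [ind_of_not_mem h]; exact ind_nonneg _ ω

/-! ### 1. The crossed form of `X_e` and its Harris lower bound -/

/-- **Harris lower bound for the cross coefficient.**  For increasing `A, B, G` and any coordinate `e`,
`X_e ≥ [μ(A¹B¹G¹) − μ(A¹B¹G⁰)] − μG¹·[μ(A⁰B⁰) − μ(A⁰B⁰G⁰)] − μG⁰·[μ(A¹B¹) − μ(A¹B¹G¹)]`.
Proof: `μ(A⁰G⁰)μ(B¹G¹) ≤ μ(A⁰B¹G⁰)` and `μ(A¹G¹)μ(B⁰G⁰) ≤ μ(A¹B⁰G⁰)` (Harris), then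
`μ(A⁰B¹G⁰) + μ(A¹B⁰G⁰) ≤ μ(A¹B¹G⁰) + μ(A⁰B⁰G⁰)` (exchange). [this work] -/
theorem cross_ge_annulus (p : κ → unitInterval) (e : κ) {A B G : Set (Set κ)}
    (hA : IsUpperSet A) (hB : IsUpperSet B) (hG : IsUpperSet G) :
    (μ⟦p, secAt e true A ∩ secAt e true B ∩ secAt e true G⟧ - μ⟦p, secAt e true A ∩ secAt e true B ∩ secAt e false G⟧)
        - μ⟦p, secAt e true G⟧ * (μ⟦p, secAt e false A ∩ secAt e false B⟧ - μ⟦p, secAt e false A ∩ secAt e false B ∩ secAt e false G⟧)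
        - μ⟦p, secAt e false G⟧ * (μ⟦p, secAt e true A ∩ secAt e true B⟧ - μ⟦p, secAt e true A ∩ secAt e true B ∩ secAt e true G⟧)
      ≤ μ⟦p, secAt e true A ∩ secAt e true B ∩ secAt e true G⟧ + μ⟦p, secAt e false A ∩ secAt e false B ∩ secAt e false G⟧
        + μ⟦p, secAt e true G⟧ * μ⟦p, secAt e false A ∩ secAt e false B ∩ secAt e false G⟧
        + μ⟦p, secAt e false G⟧ * μ⟦p, secAt e true A ∩ secAt e true B ∩ secAt e true G⟧
        - μ⟦p, secAt e true G⟧ * μ⟦p, secAt e false A ∩ secAt e false B⟧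
        - μ⟦p, secAt e false G⟧ * μ⟦p, secAt e true A ∩ secAt e true B⟧
        - μ⟦p, secAt e true A ∩ secAt e true G⟧ * μ⟦p, secAt e false B ∩ secAt e false G⟧
        - μ⟦p, secAt e false A ∩ secAt e false G⟧ * μ⟦p, secAt e true B ∩ secAt e true G⟧ := by
  have sA := secAt_false_subset_true hA e
  have sB := secAt_false_subset_true hB e
  have sG := secAt_false_subset_true hG e
  -- Harris for the two crossed products, followed by monotonicity into cells of the `0`-section of `G`
  have h1 := harris_ex_ind p (IsUpperSet.inter (isUpperSet_secAt e true hA) (isUpperSet_secAt e true hG))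
    (IsUpperSet.inter (isUpperSet_secAt e false hB) (isUpperSet_secAt e false hG))
  have h1' : μ⟦p, (secAt e true A ∩ secAt e true G) ∩ (secAt e false B ∩ secAt e false G)⟧
      ≤ μ⟦p, secAt e true A ∩ (secAt e false B ∩ secAt e false G)⟧ :=
    mu_mono p (fun ω h => ⟨h.1.1, h.2⟩)
  have h2 := harris_ex_ind p (IsUpperSet.inter (isUpperSet_secAt e false hA) (isUpperSet_secAt e false hG))
    (IsUpperSet.inter (isUpperSet_secAt e true hB) (isUpperSet_secAt e true hG))
  have h2' : μ⟦p, (secAt e false A ∩ secAt e false G) ∩ (secAt e true B ∩ secAt e true G)⟧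
      ≤ μ⟦p, secAt e false A ∩ (secAt e true B ∩ secAt e false G)⟧ :=
    mu_mono p (fun ω h => ⟨h.1.1, h.2.1, h.1.2⟩)
  -- exchange: `μ(A⁰ ∩ (B¹G⁰)) + μ(A¹ ∩ (B⁰G⁰)) ≤ μ(A¹ ∩ (B¹G⁰)) + μ(A⁰ ∩ (B⁰G⁰))`
  have h3 := mu_exchange p (P := secAt e false A) (P' := secAt e true A) (Q := secAt e false B ∩ secAt e false G)
    (Q' := secAt e true B ∩ secAt e false G) sA (Set.inter_subset_inter_left _ sB)
  have e1 : secAt e true A ∩ (secAt e true B ∩ secAt e false G) = secAt e true A ∩ secAt e true B ∩ secAt e false G :=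
    (Set.inter_assoc _ _ _).symm
  have e2 : secAt e false A ∩ (secAt e false B ∩ secAt e false G) = secAt e false A ∩ secAt e false B ∩ secAt e false G :=
    (Set.inter_assoc _ _ _).symm
  rw [e1, e2] at h3
  nlinarith [h1, h1', h2, h2', h3]

/-- **`X_e ≥ 0` whenever `A¹ ∩ B¹ ⊆ G¹`** (increasing `A, B, G`; no induction hypothesis): in `cross_ge_annulus` the last bracket vanishes and
`μ(A⁰B⁰) − μ(A⁰B⁰G⁰) ≤ μ(A¹B¹G¹) − μ(A¹B¹G⁰)` (exchange with `A⁰B⁰ ⊆ A¹B¹G¹`, `G⁰ ⊆ univ`), while `μG¹ ≤ 1`.  Covers every coordinate `e`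
with `{ω | e ∈ ω} ⊆ G` (`G¹ = univ`: the OR-step) and, in the normal form `A = (A∩G)^G`, every `e` off the support of the residual set
`R = A∩B∖G`. [this work] -/
theorem cross_nonneg_of_inter_secAt_true_subset (p : κ → unitInterval) (e : κ) {A B G : Set (Set κ)}
    (hA : IsUpperSet A) (hB : IsUpperSet B) (hG : IsUpperSet G) (h : secAt e true A ∩ secAt e true B ⊆ secAt e true G) :
    0 ≤ μ⟦p, secAt e true A ∩ secAt e true B ∩ secAt e true G⟧ + μ⟦p, secAt e false A ∩ secAt e false B ∩ secAt e false G⟧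
        + μ⟦p, secAt e true G⟧ * μ⟦p, secAt e false A ∩ secAt e false B ∩ secAt e false G⟧
        + μ⟦p, secAt e false G⟧ * μ⟦p, secAt e true A ∩ secAt e true B ∩ secAt e true G⟧
        - μ⟦p, secAt e true G⟧ * μ⟦p, secAt e false A ∩ secAt e false B⟧
        - μ⟦p, secAt e false G⟧ * μ⟦p, secAt e true A ∩ secAt e true B⟧
        - μ⟦p, secAt e true A ∩ secAt e true G⟧ * μ⟦p, secAt e false B ∩ secAt e false G⟧
        - μ⟦p, secAt e false A ∩ secAt e false G⟧ * μ⟦p, secAt e true B ∩ secAt e true G⟧ := by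
  have hX := cross_ge_annulus p e hA hB hG
  have sA := secAt_false_subset_true hA e
  have sB := secAt_false_subset_true hB e
  have sG := secAt_false_subset_true hG e
  -- `A¹B¹G¹ = A¹B¹`
  have hfull : secAt e true A ∩ secAt e true B ∩ secAt e true G = secAt e true A ∩ secAt e true B := Set.inter_eq_left.2 h
  -- exchange: `μ(A⁰B⁰ ∩ univ) + μ(A¹B¹G¹ ∩ G⁰) ≤ μ(A¹B¹G¹ ∩ univ) + μ(A⁰B⁰ ∩ G⁰)`
  have hP : secAt e false A ∩ secAt e false B ⊆ secAt e true A ∩ secAt e true B ∩ secAt e true G := by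
    rw [hfull]; exact Set.inter_subset_inter sA sB
  have h4 := mu_exchange p (P := secAt e false A ∩ secAt e false B) (P' := secAt e true A ∩ secAt e true B ∩ secAt e true G)
    (Q := secAt e false G) (Q' := (Set.univ : Set (Set κ))) hP (Set.subset_univ _)
  rw [Set.inter_univ, Set.inter_univ] at h4
  have h5 : μ⟦p, secAt e true A ∩ secAt e true B ∩ secAt e false G⟧
      ≤ μ⟦p, secAt e true A ∩ secAt e true B ∩ secAt e true G ∩ secAt e false G⟧ :=
    mu_mono p (fun ω hω => ⟨⟨hω.1, sG hω.2⟩, hω.2⟩)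
  have g1le : μ⟦p, secAt e true G⟧ ≤ 1 := by
    have := mu_mono p (Set.subset_univ (secAt e true G)); rwa [SahiCombDisjunct.ex_ind_univ] at this
  have g1nn : 0 ≤ μ⟦p, secAt e true G⟧ := ex_ind_nonneg' p _
  have d0 : 0 ≤ μ⟦p, secAt e false A ∩ secAt e false B⟧ - μ⟦p, secAt e false A ∩ secAt e false B ∩ secAt e false G⟧ :=
    sub_nonneg.2 (mu_mono p Set.inter_subset_left)
  rw [hfull] at hX h4 h5 ⊢
  nlinarith [hX, h4, h5, mul_le_mul_of_nonneg_right g1le d0, g1nn]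

/-- **`X_e ≥ 0` whenever `G⁰ = ∅`** (i.e. `G ⊆ {ω | e ∈ ω}`, the AND-step; increasing `A, B, G`): then
`X_e = μ(A¹B¹G¹) − μG¹·μ(A⁰B⁰) ≥ μ(A⁰B⁰∩G¹) − μG¹·μ(A⁰B⁰) ≥ 0` by Harris. [this work] -/
theorem cross_nonneg_of_secAt_false_third_eq_empty (p : κ → unitInterval) (e : κ) {A B G : Set (Set κ)}
    (hA : IsUpperSet A) (hB : IsUpperSet B) (hG : IsUpperSet G) (h : secAt e false G = ∅) :
    0 ≤ μ⟦p, secAt e true A ∩ secAt e true B ∩ secAt e true G⟧ + μ⟦p, secAt e false A ∩ secAt e false B ∩ secAt e false G⟧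
        + μ⟦p, secAt e true G⟧ * μ⟦p, secAt e false A ∩ secAt e false B ∩ secAt e false G⟧
        + μ⟦p, secAt e false G⟧ * μ⟦p, secAt e true A ∩ secAt e true B ∩ secAt e true G⟧
        - μ⟦p, secAt e true G⟧ * μ⟦p, secAt e false A ∩ secAt e false B⟧
        - μ⟦p, secAt e false G⟧ * μ⟦p, secAt e true A ∩ secAt e true B⟧
        - μ⟦p, secAt e true A ∩ secAt e true G⟧ * μ⟦p, secAt e false B ∩ secAt e false G⟧
        - μ⟦p, secAt e false A ∩ secAt e false G⟧ * μ⟦p, secAt e true B ∩ secAt e true G⟧ := by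
  have sA := secAt_false_subset_true hA e
  have sB := secAt_false_subset_true hB e
  have hH := harris_ex_ind p (IsUpperSet.inter (isUpperSet_secAt e false hA) (isUpperSet_secAt e false hB))
    (isUpperSet_secAt e true hG)
  have hm : μ⟦p, secAt e false A ∩ secAt e false B ∩ secAt e true G⟧ ≤ μ⟦p, secAt e true A ∩ secAt e true B ∩ secAt e true G⟧ :=
    mu_mono p (Set.inter_subset_inter (Set.inter_subset_inter sA sB) le_rfl)
  simp only [h, Set.inter_empty, SahiCombDisjunct.ex_ind_empty, mul_zero, zero_mul, add_zero, sub_zero]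
  nlinarith [hH, hm]

/-! ### 2. Consequences for `F` -/

/-- `F(A,B;G) ≥ 0` whenever `A ∩ B ⊆ G` (increasing events): then `F = μ(A∩B) − μ(A∩G)μ(B∩G) ≥ μ((A∩G)∩(B∩G)) − μ(A∩G)μ(B∩G) ≥ 0`
by Harris. [folklore] -/
theorem F_nonneg_of_inter_subset_third (p : κ → unitInterval) {A B G : Set (Set κ)}
    (hA : IsUpperSet A) (hB : IsUpperSet B) (hG : IsUpperSet G) (h : A ∩ B ⊆ G) :
    0 ≤ (1 + μ⟦p, G⟧) * μ⟦p, A ∩ B ∩ G⟧ - μ⟦p, G⟧ * μ⟦p, A ∩ B⟧ - μ⟦p, A ∩ G⟧ * μ⟦p, B ∩ G⟧ := by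
  have hfull : A ∩ B ∩ G = A ∩ B := Set.inter_eq_left.2 h
  have hH := harris_ex_ind p (IsUpperSet.inter hA hG) (IsUpperSet.inter hB hG)
  have hm : μ⟦p, (A ∩ G) ∩ (B ∩ G)⟧ ≤ μ⟦p, A ∩ B⟧ := mu_mono p (fun ω hω => ⟨hω.1.1, hω.2.1⟩)
  rw [hfull]
  nlinarith [hH, hm]

/-- **Closure step (M0), pointwise.**  For increasing `A, B, G` and a coordinate `e` with `A¹ ∩ B¹ ⊆ G¹`: if `F(A⁰,B⁰;G⁰) ≥ 0` then
`F(A,B;G) ≥ 0` (Bernstein form: `F¹ ≥ 0` by `F_nonneg_of_inter_subset_third`, `X_e ≥ 0` by `cross_nonneg_of_inter_secAt_true_subset`). [this work] -/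
theorem F_nonneg_of_inter_secAt_true_subset (p : κ → unitInterval) (e : κ) {A B G : Set (Set κ)}
    (hA : IsUpperSet A) (hB : IsUpperSet B) (hG : IsUpperSet G) (h : secAt e true A ∩ secAt e true B ⊆ secAt e true G)
    (h0 : 0 ≤ (1 + μ⟦p, secAt e false G⟧) * μ⟦p, secAt e false A ∩ secAt e false B ∩ secAt e false G⟧
        - μ⟦p, secAt e false G⟧ * μ⟦p, secAt e false A ∩ secAt e false B⟧
        - μ⟦p, secAt e false A ∩ secAt e false G⟧ * μ⟦p, secAt e false B ∩ secAt e false G⟧) :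
    0 ≤ (1 + μ⟦p, G⟧) * μ⟦p, A ∩ B ∩ G⟧ - μ⟦p, G⟧ * μ⟦p, A ∩ B⟧ - μ⟦p, A ∩ G⟧ * μ⟦p, B ∩ G⟧ := by
  have h1 := F_nonneg_of_inter_subset_third p (isUpperSet_secAt e true hA) (isUpperSet_secAt e true hB)
    (isUpperSet_secAt e true hG) h
  have hX := cross_nonneg_of_inter_secAt_true_subset p e hA hB hG h
  rw [F_bernstein_secAt p e A B G]
  have ht0 : 0 ≤ (p e : ℝ) := (p e).2.1
  have ht1 : 0 ≤ 1 - (p e : ℝ) := sub_nonneg.2 (p e).2.2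
  have a0 := mul_nonneg (pow_nonneg ht1 2) h0
  have a1 := mul_nonneg (pow_nonneg ht0 2) h1
  have a2 := mul_nonneg (mul_nonneg ht0 ht1) hX
  linarith

/-- **Closure step (M1), pointwise.**  For increasing `A, B, G` and a coordinate `e` with `G⁰ = ∅` (i.e. `G ⊆ {ω | e ∈ ω}`): if
`F(A¹,B¹;G¹) ≥ 0` then `F(A,B;G) ≥ 0` (`F⁰ = F(A⁰,B⁰;∅) = 0`, `X_e ≥ 0` by `cross_nonneg_of_secAt_false_third_eq_empty`). [this work] -/
theorem F_nonneg_of_secAt_false_third_eq_empty (p : κ → unitInterval) (e : κ) {A B G : Set (Set κ)}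
    (hA : IsUpperSet A) (hB : IsUpperSet B) (hG : IsUpperSet G) (h : secAt e false G = ∅)
    (h1 : 0 ≤ (1 + μ⟦p, secAt e true G⟧) * μ⟦p, secAt e true A ∩ secAt e true B ∩ secAt e true G⟧
        - μ⟦p, secAt e true G⟧ * μ⟦p, secAt e true A ∩ secAt e true B⟧
        - μ⟦p, secAt e true A ∩ secAt e true G⟧ * μ⟦p, secAt e true B ∩ secAt e true G⟧) :
    0 ≤ (1 + μ⟦p, G⟧) * μ⟦p, A ∩ B ∩ G⟧ - μ⟦p, G⟧ * μ⟦p, A ∩ B⟧ - μ⟦p, A ∩ G⟧ * μ⟦p, B ∩ G⟧ := by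
  have hX := cross_nonneg_of_secAt_false_third_eq_empty p e hA hB hG h
  rw [F_bernstein_secAt p e A B G]
  have h0 : 0 ≤ (1 + μ⟦p, secAt e false G⟧) * μ⟦p, secAt e false A ∩ secAt e false B ∩ secAt e false G⟧
        - μ⟦p, secAt e false G⟧ * μ⟦p, secAt e false A ∩ secAt e false B⟧
        - μ⟦p, secAt e false A ∩ secAt e false G⟧ * μ⟦p, secAt e false B ∩ secAt e false G⟧ := by
    simp [h, SahiCombDisjunct.ex_ind_empty]
  have ht0 : 0 ≤ (p e : ℝ) := (p e).2.1
  have ht1 : 0 ≤ 1 - (p e : ℝ) := sub_nonneg.2 (p e).2.2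
  have a0 := mul_nonneg (pow_nonneg ht1 2) h0
  have a1 := mul_nonneg (pow_nonneg ht0 2) h1
  have a2 := mul_nonneg (mul_nonneg ht0 ht1) hX
  linarith

omit [Fintype κ] in
/-- If `{ω | e ∈ ω} ⊆ G` then the `1`-section of `G` along `e` is everything. [folklore] -/
theorem secAt_true_eq_univ_of_coord_subset {e : κ} {G : Set (Set κ)} (h : {ω : Set κ | e ∈ ω} ⊆ G) :
    secAt e true G = Set.univ := by
  ext ω
  simp only [mem_secAt, forceAt, cond_true, Set.mem_univ, iff_true]
  exact h (Set.mem_insert e ω)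

omit [Fintype κ] in
/-- If `G ⊆ {ω | e ∈ ω}` then the `0`-section of `G` along `e` is empty. [folklore] -/
theorem secAt_false_eq_empty_of_subset_coord {e : κ} {G : Set (Set κ)} (h : G ⊆ {ω : Set κ | e ∈ ω}) :
    secAt e false G = ∅ := by
  ext ω
  simp only [mem_secAt, forceAt, cond_false, Set.mem_empty_iff_false, iff_false]
  intro hω
  have := h hω
  simp at this

/-- **OR-CLOSURE of the class `{G : F(·,·;G) ≥ 0}`.**  Let `G` be increasing with `{ω | e ∈ ω} ⊆ G` (so `G = x_e ∨ G⁰`).  If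
`F(A',B';G⁰) ≥ 0` for all increasing `A', B'`, then `F(A,B;G) ≥ 0` for all increasing `A, B`. [this work] -/
theorem F_nonneg_forall_of_coord_subset_third (p : κ → unitInterval) (e : κ) {G : Set (Set κ)} (hG : IsUpperSet G)
    (he : {ω : Set κ | e ∈ ω} ⊆ G)
    (hH : ∀ (A' B' : Set (Set κ)), IsUpperSet A' → IsUpperSet B' →
      0 ≤ (1 + μ⟦p, secAt e false G⟧) * μ⟦p, A' ∩ B' ∩ secAt e false G⟧ - μ⟦p, secAt e false G⟧ * μ⟦p, A' ∩ B'⟧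
        - μ⟦p, A' ∩ secAt e false G⟧ * μ⟦p, B' ∩ secAt e false G⟧) :
    ∀ (A B : Set (Set κ)), IsUpperSet A → IsUpperSet B →
      0 ≤ (1 + μ⟦p, G⟧) * μ⟦p, A ∩ B ∩ G⟧ - μ⟦p, G⟧ * μ⟦p, A ∩ B⟧ - μ⟦p, A ∩ G⟧ * μ⟦p, B ∩ G⟧ := by
  intro A B hA hB
  have huniv := secAt_true_eq_univ_of_coord_subset he
  refine F_nonneg_of_inter_secAt_true_subset p e hA hB hG (by rw [huniv]; exact Set.subset_univ _) ?_
  exact hH _ _ (isUpperSet_secAt e false hA) (isUpperSet_secAt e false hB)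

/-- **AND-CLOSURE of the class `{G : F(·,·;G) ≥ 0}`.**  Let `G` be increasing with `G ⊆ {ω | e ∈ ω}` (so `G = x_e ∧ G¹`).  If
`F(A',B';G¹) ≥ 0` for all increasing `A', B'`, then `F(A,B;G) ≥ 0` for all increasing `A, B`. [this work] -/
theorem F_nonneg_forall_of_third_subset_coord (p : κ → unitInterval) (e : κ) {G : Set (Set κ)} (hG : IsUpperSet G)
    (he : G ⊆ {ω : Set κ | e ∈ ω})
    (hH : ∀ (A' B' : Set (Set κ)), IsUpperSet A' → IsUpperSet B' →
      0 ≤ (1 + μ⟦p, secAt e true G⟧) * μ⟦p, A' ∩ B' ∩ secAt e true G⟧ - μ⟦p, secAt e true G⟧ * μ⟦p, A' ∩ B'⟧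
        - μ⟦p, A' ∩ secAt e true G⟧ * μ⟦p, B' ∩ secAt e true G⟧) :
    ∀ (A B : Set (Set κ)), IsUpperSet A → IsUpperSet B →
      0 ≤ (1 + μ⟦p, G⟧) * μ⟦p, A ∩ B ∩ G⟧ - μ⟦p, G⟧ * μ⟦p, A ∩ B⟧ - μ⟦p, A ∩ G⟧ * μ⟦p, B ∩ G⟧ := by
  intro A B hA hB
  exact F_nonneg_of_secAt_false_third_eq_empty p e hA hB hG (secAt_false_eq_empty_of_subset_coord he)
    (hH _ _ (isUpperSet_secAt e true hA) (isUpperSet_secAt e true hB))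

end SahiFInduction

end Summit.CriticalPhenomena.PercolationContinuityZ3.Theorems
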